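/-
Copyright: cell `pub-balaban-gaps` (G2), seat ne6 (row NE7b), `prover-pub-balaban-gaps-ne6-g16-0`. Project licence.
-/
import Summits.QuantumFields.BalabanUV.T4Continuum.Spine.NE7b.CompactFibreHalvedActionSUN
import Summits.QuantumFields.BalabanUV.T4Continuum.Spine.NE7b.CompactFibreWindowSU2DoublingHaar

/-!
# JUNCTION (census V40d): the halved-action (LCS) letter of the `SU(2)` fibre WITH THE SHARP CONSTANT — `∫e^{δβs}e^{−βs} dHaar ≤ (1−δ)^{−3∕2}·∫e^{−βs} dHaar`
# for ALL `β ≥ 0`, `0 ≤ δ < 1` (`s = Re tr(1 − V)`), and the region letter `exp(#B·(3∕2)·log(1−δ)⁻¹)` with `c = 0` (V38's layer cake + V40c's `D = 1`; MODEL, [folklore])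

Cell `pub-balaban-gaps` (G2 spine census) for the `pub-balaban` T⁴ crux NE7b (NOT PRINTED, NOT PROVED).  One-theorem junction (filed once the parents' oleans exist).
This is the refuter NE7bREF-G99-POST3's instrument no. 7 («D_true = 1, c = 0 for N = 2») as a theorem: the per-plaquette additive constant of V38's
`exists_lcsLetter_compactFibre` vanishes for `SU(2)`.  No `def`, zero `sorry`, nothing of Bałaban's asserted.  BY-NAME EFFECT ON THE WALL: NONE.
HONEST DEPENDENCY: continuum YM on T⁴ ⇐ BetaPertH ∧ nine spine estimates (0/9 proved); BetaPertH ⇐ (D1) ∧ (D4) ∧ CAP+tail;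
G-an2-4 gates asym, D1 and NE2/3/4.  This file changes none of it.
-/

set_option autoImplicit false

noncomputable section

open MeasureTheory Real Set
open Literature.MathematicalPhysics.QuantumFieldTheory (haarProbability)
open Literature.MathematicalPhysics.QuantumFieldTheory.UnitaryCayley (re_trace_one_sub)
open Summit.QuantumFields.BalabanUV.T4Continuum.NE7b.CompactFibreHalvedActionSUN (integral_exp_neg_mul_le_of_sublevel measurable_re_trace_one_sub pi_halvedAction_moment_le)
open Summit.QuantumFields.BalabanUV.T4Continuum.NE7b.CompactFibreWindowSU2DoublingHaar (haarReal_traceWindow_doubling_one)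

namespace Summit.QuantumFields.BalabanUV.T4Continuum.NE7b.CompactFibreHalvedActionSU2Sharp

/-- **THE HALVED-ACTION MOMENT ON THE `SU(2)` FIBRE WITH THE SHARP CONSTANT**: for all `β ≥ 0` and `0 ≤ δ < 1`,
`∫ e^{δβ·Re tr(1−V)}·e^{−β·Re tr(1−V)} dHaar_{SU(2)} ≤ ((√(1−δ))⁻¹)³·∫ e^{−β·Re tr(1−V)} dHaar_{SU(2)}` — V38's `exists_halvedAction_moment_le` for `N = 2` with
`D = 1` (exactly the Gaussian factor `(1−δ)^{−dim SU(2)∕2}`, no additive constant). [folklore] -/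
theorem halvedAction_moment_le_sharp {β δ : ℝ} (hβ : 0 ≤ β) (hδ0 : 0 ≤ δ) (hδ1 : δ < 1) :
    ∫ V, Real.exp (δ * β * (Matrix.trace (1 - (V : Matrix (Fin 2) (Fin 2) ℂ))).re) * Real.exp (-(β * (Matrix.trace (1 - (V : Matrix (Fin 2) (Fin 2) ℂ))).re)) ∂(haarProbability (Matrix.specialUnitaryGroup (Fin 2) ℂ))
      ≤ (Real.sqrt (1 - δ))⁻¹ ^ 3 * ∫ V, Real.exp (-(β * (Matrix.trace (1 - (V : Matrix (Fin 2) (Fin 2) ℂ))).re)) ∂(haarProbability (Matrix.specialUnitaryGroup (Fin 2) ℂ)) := by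
  set μ := haarProbability (Matrix.specialUnitaryGroup (Fin 2) ℂ) with hμ
  have h1δ : 0 < 1 - δ := by linarith
  have hsqrt : 0 < Real.sqrt (1 - δ) := Real.sqrt_pos.2 h1δ
  set l : ℝ := (Real.sqrt (1 - δ))⁻¹ with hl
  have hl1 : 1 ≤ l := by
    rw [hl, one_le_inv₀ hsqrt]
    have : Real.sqrt (1 - δ) ≤ Real.sqrt 1 := Real.sqrt_le_sqrt (by linarith)
    rwa [Real.sqrt_one] at this
  have hl2 : l ^ 2 = (1 - δ)⁻¹ := by rw [hl, inv_pow, Real.sq_sqrt h1δ.le]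
  have hrew : ∀ V : Matrix.specialUnitaryGroup (Fin 2) ℂ,
      Real.exp (δ * β * (Matrix.trace (1 - (V : Matrix (Fin 2) (Fin 2) ℂ))).re) * Real.exp (-(β * (Matrix.trace (1 - (V : Matrix (Fin 2) (Fin 2) ℂ))).re))
        = Real.exp (-((1 - δ) * β * (Matrix.trace (1 - (V : Matrix (Fin 2) (Fin 2) ℂ))).re)) := fun V => by
    rw [← Real.exp_add]; ring_nf
  simp_rw [hrew]
  have hsub : ∀ L : ℝ, μ.real {V : Matrix.specialUnitaryGroup (Fin 2) ℂ | (1 - δ) * β * (Matrix.trace (1 - (V : Matrix (Fin 2) (Fin 2) ℂ))).re ≤ L}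
      ≤ l ^ 3 * μ.real {V : Matrix.specialUnitaryGroup (Fin 2) ℂ | β * (Matrix.trace (1 - (V : Matrix (Fin 2) (Fin 2) ℂ))).re ≤ L} := by
    intro L
    rcases hβ.eq_or_lt with hβ0 | hβpos
    · subst hβ0
      simp only [mul_zero, zero_mul]
      have h1 : (1 : ℝ) ≤ l ^ 3 := one_le_pow₀ hl1
      calc μ.real {V : Matrix.specialUnitaryGroup (Fin 2) ℂ | (0 : ℝ) ≤ L} = 1 * μ.real {V : Matrix.specialUnitaryGroup (Fin 2) ℂ | (0 : ℝ) ≤ L} := (one_mul _).symm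
        _ ≤ l ^ 3 * μ.real {V : Matrix.specialUnitaryGroup (Fin 2) ℂ | (0 : ℝ) ≤ L} := mul_le_mul_of_nonneg_right h1 measureReal_nonneg
    · have hβ' : 0 < (1 - δ) * β := mul_pos h1δ hβpos
      have hA : {V : Matrix.specialUnitaryGroup (Fin 2) ℂ | (1 - δ) * β * (Matrix.trace (1 - (V : Matrix (Fin 2) (Fin 2) ℂ))).re ≤ L}
          = {V : Matrix.specialUnitaryGroup (Fin 2) ℂ | (Matrix.trace (1 - (V : Matrix (Fin 2) (Fin 2) ℂ))).re ≤ l ^ 2 * (L / β)} := by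
        ext V; simp only [Set.mem_setOf_eq]
        rw [hl2, show (1 - δ)⁻¹ * (L / β) = L / ((1 - δ) * β) by field_simp, le_div_iff₀ hβ']
        constructor <;> intro h <;> linarith
      have hB : {V : Matrix.specialUnitaryGroup (Fin 2) ℂ | β * (Matrix.trace (1 - (V : Matrix (Fin 2) (Fin 2) ℂ))).re ≤ L}
          = {V : Matrix.specialUnitaryGroup (Fin 2) ℂ | (Matrix.trace (1 - (V : Matrix (Fin 2) (Fin 2) ℂ))).re ≤ L / β} := by
        ext V; simp only [Set.mem_setOf_eq]
        rw [le_div_iff₀ hβpos]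
        constructor <;> intro h <;> linarith
      rw [hA, hB]
      exact haarReal_traceWindow_doubling_one hl1 (L / β)
  have hK : 0 ≤ l ^ 3 := by positivity
  have := integral_exp_neg_mul_le_of_sublevel μ measurable_re_trace_one_sub
    (fun V => by rw [re_trace_one_sub (Matrix.mem_specialUnitaryGroup_iff.1 V.2).1]; positivity) hβ hK hsub
  simpa only [mul_assoc] using this


/-- **THE `LocCondStability` LETTER OF THE `SU(2)` REFERENCE STATE WITH `c = 0`**: on the product Haar of `B → SU(2)` with `S(v) = Σ_b Re tr(1 − v_b)`, for all `β ≥ 0`,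
`0 ≤ δ < 1`: `∫ e^{δβS}·e^{−βS} dκ ≤ exp(#B·(3∕2)·log(1−δ)⁻¹)·∫ e^{−βS} dκ` — V38's `exists_lcsLetter_compactFibre` for `N = 2` with the additive constant `c = 0`. [folklore] -/
theorem lcsLetter_SU2_sharp {B : Type*} [Fintype B] {β δ : ℝ} (hβ : 0 ≤ β) (hδ0 : 0 ≤ δ) (hδ1 : δ < 1) :
    ∫ v, Real.exp (δ * β * ∑ b, (Matrix.trace (1 - ((v b : Matrix.specialUnitaryGroup (Fin 2) ℂ) : Matrix (Fin 2) (Fin 2) ℂ))).re)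
        * Real.exp (-(β * ∑ b, (Matrix.trace (1 - ((v b : Matrix.specialUnitaryGroup (Fin 2) ℂ) : Matrix (Fin 2) (Fin 2) ℂ))).re)) ∂(Measure.pi fun _ : B => haarProbability (Matrix.specialUnitaryGroup (Fin 2) ℂ))
      ≤ Real.exp (Fintype.card B * ((3 : ℝ) / 2 * Real.log (1 - δ)⁻¹))
        * ∫ v, Real.exp (-(β * ∑ b, (Matrix.trace (1 - ((v b : Matrix.specialUnitaryGroup (Fin 2) ℂ) : Matrix (Fin 2) (Fin 2) ℂ))).re)) ∂(Measure.pi fun _ : B => haarProbability (Matrix.specialUnitaryGroup (Fin 2) ℂ)) := by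
  have h1δ : 0 < 1 - δ := by linarith
  have hsqrt : 0 < Real.sqrt (1 - δ) := Real.sqrt_pos.2 h1δ
  have hpi := pi_halvedAction_moment_le (N := 2) (B := B) (halvedAction_moment_le_sharp hβ hδ0 hδ1)
  have hconst : ((Real.sqrt (1 - δ))⁻¹ ^ 3) ^ Fintype.card B = Real.exp (Fintype.card B * ((3 : ℝ) / 2 * Real.log (1 - δ)⁻¹)) := by
    rw [← Real.exp_log (pow_pos (inv_pos.2 hsqrt) 3), ← Real.exp_nat_mul, Real.log_pow, Real.log_inv, Real.log_sqrt h1δ.le, Real.log_inv]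
    ring_nf
  rw [hconst] at hpi
  exact hpi

end Summit.QuantumFields.BalabanUV.T4Continuum.NE7b.CompactFibreHalvedActionSU2Sharp

end
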